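import Literature.Analysis.ValidatedNumerics.TrigLogTables
import Literature.Analysis.SpecialFunctions.KernelLog
import Literature.Barriers.RiemannHypothesis.TuranPartialSumsCheck
import HarnessLib

/-!
# Sections of `ζ` beyond `σ = 1`: the window checker (computable core)

Barrier catalogue `Literature/Barriers/RiemannHypothesis/`, companion of `TuranPartialSums.lean`
(step U2 of the plan to prove `TuranPartialSums`). This file contains ONLY computable functions,
written for evaluation by the kernel (`decide +kernel`), on top of the tree's verified fixed-point
interval engine (`Literature.Analysis.ValidatedNumerics.Numerics.FI/CB`, scale `2^48`) and kernel
logarithms (`KernelLog.logIv`, `log1pIv`). Their meaning — a passing window certifies the hypotheses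
of the `σ = 1` criterion `exists_zero_of_criterion` (`TuranPartialSumsCriterion.lean`) for EVERY `N`
of a window `[N₁, N₂]` — is `TuranPartialSumsWindowSound.lean`. Nothing is asserted here.

## The computation (notation of the soundness file)

All abscissae live on ONE global grid `g₀ < g₁ < ⋯` (`gridPt`: `g₀ = 20`,
`g_{i+1} = g_i + max(1, ⌊g_i/50⌋)`, 2% steps). A window is `[N₁, N₂] = [g_{i₁}, g_{i₂}]`; the
fixed-phase primes are those `≤ Y' = g_{i_Y}` (`Y'² ≥ N₂`), with phases `ω(p) = p^{-iτ}`, `τ = tn/td`;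
the free primes of `N` are those in `(Y', N]`. With `s = 1 + iτ`, `H_k = ∑_{m≤k} m^{-s}`, the criterion
at `N₁` compares `R = ∑_{Y'<p≤N₁} |H_{⌊N₁/p⌋}|/p` with `|B|`,
`B = H_{N₁} − ∑_{Y'<p≤N₁} p^{-s} H_{⌊N₁/p⌋}`; the bins are the grid cells `(g_{i−1}, g_i]`,
`i_Y < i ≤ i₁`, walked downwards (so that `k = ⌊N₁/p⌋` increases):

* logarithms of the edges and of the `k`-range ends are carried incrementally (`log1pIv` of the
  ratio; an absolute `logIv` where the ratio exceeds `3/2`), and so are the phases `e^{-iτ log t}`: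
  a rotation by the small angle `τ·Δlog` (Taylor with `Real.cos_bound`, `Real.sin_bound`;
  `cosSinSmall`), the phases over a bin being the carried point phase times a small arc box
  (`arcPos`/`arcNeg`); a full `CB.expI` only at a chunk start and after a large ratio;
* `H`-boxes: for `k ≤ k₀` from the table `H_1, …, H_{k₀}` (interval sums of `m^{-s}`, `hTab`), for
  `k ≥ k₀` from `H_k = H_{k₀} + i(k^{-iτ} − k₀^{-iτ})/τ + E`, `|E| ≤ |s|(k₀⁻² + k₀⁻¹)`
  (`TuranPartialSumsHsum`); the `k`-range of the bin `(u, v]` is taken as `[⌊N₁/v⌋, ⌊N₁/u⌋]`;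
* table bins (`i ≤ i_X`, `g_{i_X} = X`): exact prime counts `c_i = π(g_i) − π(g_{i−1})` from the
  kernel-verified table `piTab`; envelope bins (`i > i_X`): the density main term
  `∑_{n ∈ bin} 1/(n log n)` and Abel-summation variation terms under `α t ≤ θ(t) ≤ β t` (`t ≥ X`);
* the window is cut into chunks of bins (`chunkOut`, one `decide` each; the kernel's cost grows
  faster than linearly in the length of one evaluation), combined by `verdict`/`combine` (sums, the
  jump terms `J`, the drift `Δ = (N₂ − N₁)/(N₁ + 1)` to the other `N` of the window, the final
  inequalities).

## References

* [PlattTrudgian2016] D. J. Platt, T. S. Trudgian, LMS J. Comput. Math. 19 (2016), §2 (interval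
  arithmetic for the sections; here at `σ = 1` with free large primes).
* [Montgomery1983] H. L. Montgomery, *Zeros of approximations to the zeta function* (1983), §2.
-/

open Literature.Analysis.ValidatedNumerics.Numerics
open Literature.Analysis.SpecialFunctions.KernelLog

namespace Literature.Barriers.RiemannHypothesis.TuranWindow

/-! ### Scalars, logarithms, square roots -/

/-- `2^48`, the scale of `FI`, as an integer. [folklore] -/
def SCZ : ℤ := 281474976710656

/-- Rescale a `2^80`-scaled enclosure `(lo, hi)` of `KernelLog` to an `FI` (scale `2^48`). [folklore] -/
def ofLog80 (p : ℤ × ℤ) : FI := ⟨p.1 / 4294967296, cdiv p.2 4294967296⟩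

/-- `log n` (`n ≥ 1`) as an `FI`, from `KernelLog.logIv`. [folklore] -/
def logFI (n : ℕ) : Option FI :=
  match logIv n with
  | some p => some (ofLog80 p)
  | none => none

/-- `log(1 + d/u)` (`2d ≤ u`, `0 < u`) as an `FI`, from `KernelLog.log1pIv`. [folklore] -/
def log1pFI (d u : ℕ) : Option FI :=
  match log1pIv d u with
  | some p => some (ofLog80 p)
  | none => none

/-- `log b` from `L ∋ log a` (`a ≤ b`): returns the new enclosure and, when `2(b − a) ≤ a`, also the
(thin) enclosure of the increment `log(b/a)`; otherwise the increment is `none` and the logarithm is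
recomputed from scratch. [folklore] -/
def logUp (L : FI) (a b : ℕ) : Option (FI × Option FI) :=
  bif Nat.ble (2 * (b - a)) a && Nat.blt 0 a then
    match log1pFI (b - a) a with
    | some D => some (L.add D, some D)
    | none => none
  else
    match logFI b with
    | some L' => some (L', none)
    | none => none

/-- `log u` from `L ∋ log v` (`u ≤ v`): as `logUp`, downwards. [folklore] -/
def logDown (L : FI) (v u : ℕ) : Option (FI × Option FI) :=
  bif Nat.ble (2 * (v - u)) u && Nat.blt 0 u then
    match log1pFI (v - u) u with
    | some D => some (L.sub D, some D)
    | none => none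
  else
    match logFI u with
    | some L' => some (L', none)
    | none => none

/-- Verified integer square root bracket of a natural number: `some s` with `s² ≤ q < (s+1)²`
(Newton candidate of `TuranCheck.isqrt`, checked), else `none`. [folklore] -/
def isqrtChecked (q : ℕ) : Option ℕ :=
  let s := TuranCheck.isqrt q
  bif Nat.ble (s * s) q && Nat.blt q ((s + 1) * (s + 1)) then some s else none

/-- `min |x|` over an interval, scaled (`0` if the interval contains `0`). [folklore] -/
def absLoFI (I : FI) : ℤ := if 0 ≤ I.lo then I.lo else if I.hi ≤ 0 then -I.hi else 0

/-- A lower bound (scaled) for `|z|` over a box: `⌊√(a² + b²)⌋` with `a = min|re|`, `b = min|im|`. [folklore] -/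
def absLoCB (B : CB) : Option ℤ :=
  let a := (absLoFI B.re).toNat
  let b := (absLoFI B.im).toNat
  match isqrtChecked (a * a + b * b) with
  | some s => some (s : ℤ)
  | none => none

/-- An upper bound (scaled) for `|z|` over a box: `⌊√(A² + B²)⌋ + 1`, `A = max|re|`, `B = max|im|`. [folklore] -/
def absHiCB (B : CB) : Option ℤ :=
  let a := B.re.absHi.toNat
  let b := B.im.absHi.toNat
  match isqrtChecked (a * a + b * b) with
  | some s => some ((s : ℤ) + 1)
  | none => none

/-- Hull of two boxes. [folklore] -/
def hullCB (A B : CB) : CB := ⟨A.re.hull B.re, A.im.hull B.im⟩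

/-! ### Phases: absolute, small rotations, arcs -/

/-- `e^{-iθ}` for `θ ∈ τ·[L.lo, M.hi]` (all phases `t^{-iτ}` with `log t` between two enclosures):
the box `expI` of the angle interval `[−τ M.hi, −τ L.lo]`, `τ = tn/td`. [folklore] -/
def phaseBox (tn td : ℕ) (L M : FI) : Option CB :=
  let a : FI := ⟨L.lo, M.hi⟩
  let θ : FI := ((a.mulInt tn).divNat td).neg
  CB.expI θ

/-- **Small-angle cosine and sine.** For an angle interval `D ⊂ [0, 1]`: enclosures `c ∋ cos d` and
`s ∋ sin d` valid for every `d ∈ D` (`1 − d²/2 ≤ cos d ≤ 1 − d²/2 + (5/96)d⁴`,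
`|sin d − (d − d³/6)| ≤ d⁵/100`). [folklore] -/
def cosSinSmall (D : FI) : Option (FI × FI) :=
  bif decide (0 ≤ D.lo) && decide (D.hi ≤ SCZ) then
    let X2 := D.sqr
    let X3 := X2.mul D
    let X4 := X2.sqr
    let X5 := X4.mul D
    let c : FI := ⟨SCZ - cdiv X2.hi 2, SCZ - X2.lo / 2 + cdiv (5 * X4.hi) 96⟩
    let rs : ℤ := cdiv X5.hi 100
    let s : FI := (D.sub (X3.divNat 6)).widen rs
    some (c, s)
  else none

/-- The angle interval `τ·D` (`τ = tn/td`). [folklore] -/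
def scaleAngle (tn td : ℕ) (D : FI) : FI := (D.mulInt tn).divNat td

/-- Largest angle (`0.05`, scaled) for which the small rotation is used (cosine remainder
`≤ (5/96)·0.05⁴ ≈ 3.3·10⁻⁷` per step); beyond it the phase is recomputed by `expI`. [folklore] -/
def ROTMAX : ℤ := 14073748835533

/-- Arc box of `e^{+iφ}`, `0 ≤ φ ≤ d` for some `d ∈ D` (`D ⊂ [0,1]`): `[cos, 1] × [0, sin]`. [folklore] -/
def arcPos (cs : FI × FI) : CB := ⟨⟨cs.1.lo, SCZ⟩, ⟨0, max 0 cs.2.hi⟩⟩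

/-- Arc box of `e^{−iφ}`, `0 ≤ φ ≤ d` for some `d ∈ D`: `[cos, 1] × [−sin, 0]`. [folklore] -/
def arcNeg (cs : FI × FI) : CB := ⟨⟨cs.1.lo, SCZ⟩, ⟨-(max 0 cs.2.hi), 0⟩⟩

/-- Point box of `e^{+id}`, `d ∈ D`. [folklore] -/
def rotPos (cs : FI × FI) : CB := ⟨cs.1, cs.2⟩

/-- Point box of `e^{−id}`, `d ∈ D`. [folklore] -/
def rotNeg (cs : FI × FI) : CB := ⟨cs.1, cs.2.neg⟩

/-- **Phase step downwards** (edges `v → u`, `u ≤ v`). From `Φ ∋ e^{-iτ log v}`, the optional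
increment `D ∋ log(v/u)` and the enclosures `Lu ∋ log u`, `Lv ∋ log v`: returns `(Φbin, Φu)` with
`Φbin ∋ e^{-iτ y}` for every `y ∈ [log u, log v]` and `Φu ∋ e^{-iτ log u}`. A rotation when the
angle is small, else two `expI`. [folklore] -/
def phaseDown (tn td : ℕ) (Φ : CB) (incr : Option FI) (Lu Lv : FI) : Option (CB × CB) :=
  match incr with
  | some D =>
    let A := scaleAngle tn td D
    match (bif decide (A.hi ≤ ROTMAX) then cosSinSmall A else none) with
    | some cs => some (Φ.mul (arcPos cs), Φ.mul (rotPos cs))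
    | none =>
      match phaseBox tn td Lu Lv, phaseBox tn td Lu Lu with
      | some B, some Pt => some (B, Pt)
      | _, _ => none
  | none =>
    match phaseBox tn td Lu Lv, phaseBox tn td Lu Lu with
    | some B, some Pt => some (B, Pt)
    | _, _ => none

/-- **Phase step upwards** (`a → b`, `a ≤ b`): from `Ψ ∋ e^{-iτ log a}`: `(Ψrange, Ψb)` with
`Ψrange ∋ e^{-iτ y}` for all `y ∈ [log a, log b]` and `Ψb ∋ e^{-iτ log b}`. [folklore] -/
def phaseUp (tn td : ℕ) (Ψ : CB) (incr : Option FI) (La Lb : FI) : Option (CB × CB) :=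
  match incr with
  | some D =>
    let A := scaleAngle tn td D
    match (bif decide (A.hi ≤ ROTMAX) then cosSinSmall A else none) with
    | some cs => some (Ψ.mul (arcNeg cs), Ψ.mul (rotNeg cs))
    | none =>
      match phaseBox tn td La Lb, phaseBox tn td Lb Lb with
      | some B, some Pt => some (B, Pt)
      | _, _ => none
  | none =>
    match phaseBox tn td La Lb, phaseBox tn td Lb Lb with
    | some B, some Pt => some (B, Pt)
    | _, _ => none

/-! ### The grid -/

/-- Next grid point: a 2% step (at least `1`). [folklore] -/
def gridNext (g : ℕ) : ℕ := g + max 1 (g / 50)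

/-- `g_i`: `g_0 = 20`, `g_{i+1} = gridNext g_i` (computed by iteration). [folklore] -/
def gridGo : ℕ → ℕ → ℕ
  | 0, g => g
  | n + 1, g => gridGo n (gridNext g)

/-- The `i`-th grid point. [folklore] -/
def gridPt (i : ℕ) : ℕ := gridGo i 20

/-- The descending list `[g_{a+n-1}, …, g_{a+1}, g_a]` from `g = g_a` (accumulated). [folklore] -/
def gridDescGo : ℕ → ℕ → List ℕ → List ℕ
  | 0, _, acc => acc
  | n + 1, g, acc => gridDescGo n (gridNext g) (g :: acc)

/-- `[g_{b-1}, g_{b-2}, …, g_a]` (the lower edges of the bins `a < i ≤ b`, top first). [folklore] -/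
def gridDesc (a b : ℕ) : List ℕ := gridDescGo (b - a) (gridPt a) []

/-! ### Window parameters and chunk outputs -/

/-- The data of one window (all claimed by the generator, checked where it matters):
indices `i₁ < i₂` (`[N₁, N₂] = [g_{i₁}, g_{i₂}]`), `iY` (`Y' = g_{iY}`, `Y'² ≥ N₂`), the twist
`τ = tn/td > 0`, the anchor `k₀` and a claimed box `Hk0 ∋ H_{k₀}(1+iτ)` (verified by the chunks that
build the table), and the chunk boundaries `splits` (grid indices `i₁ = j₀ > j₁ > ⋯ > j_m = iY`; chunk
`c` treats the bins `j_{c+1} < i ≤ j_c`). [folklore] -/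
structure WinParams where
  /-- index of `N₁` -/
  i1 : ℕ
  /-- index of `N₂` -/
  i2 : ℕ
  /-- index of `Y'` -/
  iY : ℕ
  /-- numerator of `τ` -/
  tn : ℕ
  /-- denominator of `τ` -/
  td : ℕ
  /-- anchor of the Euler–Maclaurin formula -/
  k0 : ℕ
  /-- claimed enclosure of `H_{k₀}(s)` -/
  Hk0 : CB
  /-- chunk boundaries (grid indices, decreasing, from `i1` to `iY`) -/
  splits : List ℕ
  deriving DecidableEq

/-- Global constants: the table/envelope threshold index `i_X` (`g_{i_X} = X`), and the envelope
constants `α = an/ed ≤ θ(t)/t ≤ β = bn/ed` for `t ≥ X`. [folklore] -/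
structure EnvConsts where
  /-- index of `X` in the grid -/
  iX : ℕ
  /-- numerator of `α` -/
  an : ℕ
  /-- numerator of `β` -/
  bn : ℕ
  /-- common denominator -/
  ed : ℕ
  deriving DecidableEq

/-- The output of one chunk (all reals scaled by `2^48`, rounded in the safe direction):
`ok`; `Rtab` ≤ the table part of `R`; `mainm` ≤ `∑_env μ_lo·min|H|`; `mainM` ≥ `∑_env μ_hi·max|H|`
(`μ_hi = (v−u)/(u log u) ≥ ∑_{u<n≤v} 1/((n−1) log n)`);
`R2` ≥ `∑_env max|H|·(1/log(u+1) − 1/log(v+1))`; `P0` ∋ the chunk's part of `∑ p^{-s}H` (table) plus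
density main term (envelope); `maxco` ≥ `max |H|/(u+1)`; `GX` ≥ `max|H|/log(u+1)` at the first envelope
bin of the window, index `max(i_X, i_Y) + 1` (else `0`); `allMono`/`kcert`: every bin of the chunk passed the monotonicity test, and the largest
`k` reached. [folklore] -/
structure ChunkOut where
  /-- all checks of the chunk passed -/
  ok : Bool
  /-- lower bound, table part of `R` -/
  Rtab : ℤ
  /-- lower bound, envelope density term with `min |H|` -/
  mainm : ℤ
  /-- upper bound, envelope density term with `max |H|` -/
  mainM : ℤ
  /-- upper bound, the `R₂` variation term -/
  R2 : ℤ
  /-- box for the chunk's part of `P₀` -/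
  P0 : CB
  /-- upper bound for `max_p |H_{⌊N₁/p⌋}|/p` over the chunk -/
  maxco : ℤ
  /-- boundary weight at the table/envelope transition (if inside the chunk) -/
  GX : ℤ
  /-- all bins of the chunk certified `|H_k|` increasing in `k` -/
  allMono : Bool
  /-- largest `k` of the chunk -/
  kcert : ℕ
  deriving DecidableEq

/-- The failed chunk output. [folklore] -/
def ChunkOut.fail : ChunkOut := ⟨false, 0, 0, 0, 0, CB.ofInt 0, 0, 0, false, 0⟩

/-! ### The table `H_1, …, H_{k₀}` -/

/-- Build `[H_{k₀}, H_{k₀−1}, …, H_1]` (head = `H_{k₀}`), `H_k = ∑_{m ≤ k} m^{-s}`,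
`m^{-s} = e^{-iτ log m}/m`, carrying `log m` and the phase incrementally, together with the monotonicity
certificate "`|H_k|` increasing for `k ≤ k₀`" (`Re(H_{m−1}·conj(m^{-iτ})) ≥ 0` for `2 ≤ m ≤ k₀`).
Arguments: fuel, `m`, `L ∋ log(m−1)`, `Φ ∋ (m−1)^{-iτ}`, `H = H_{m−1}`, accumulator, flag. [folklore] -/
def hTabGo (tn td : ℕ) : ℕ → ℕ → FI → CB → CB → List CB → Bool → Option (List CB × Bool)
  | 0, _, _, _, _, acc, mono => some (acc, mono)
  | fuel + 1, m, L, Φ, H, acc, mono =>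
    match logUp L (m - 1) m with
    | none => none
    | some (L', incr) =>
      match phaseUp tn td Φ incr L L' with
      | none => none
      | some (_, Φ') =>
        let H' := H.add (Φ'.divNat m)
        let mono' := mono && (Nat.ble m 1 || decide (0 ≤ ((H.mul Φ'.conj).re).lo))
        -- force the new values before storing them
        bif decide (H'.re.lo ≤ H'.re.hi) && decide (H'.im.lo ≤ H'.im.hi) &&
            decide (L'.lo ≤ L'.hi) && decide (Φ'.re.lo ≤ Φ'.re.hi) && decide (Φ'.im.lo ≤ Φ'.im.hi) then
          hTabGo tn td fuel (m + 1) L' Φ' H' (H' :: acc) mono'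
        else none

/-- `some ([H_{k₀}, …, H_1], mono)`; starts at `m = 1` with `log 1 = 0`, `1^{-iτ} = 1`, `H_0 = 0`
(the first step `logUp _ 0 1` recomputes `log 1` from scratch). [folklore] -/
def hTab (tn td k0 : ℕ) : Option (List CB × Bool) :=
  hTabGo tn td k0 1 (FI.ofInt 0) (CB.ofInt 1) (CB.ofInt 0) [] true

/-- `H_k` from the table (`1 ≤ k ≤ k₀`; the list is `[H_{k₀}, …, H_1]`). [folklore] -/
def hTabGet (tab : List CB) (k0 k : ℕ) : CB := tab.getD (k0 - k) (CB.ofInt 0)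

/-- Hull of the table boxes `H_k` for `k ∈ [a, a + n]`, fuel-recursive on `n`. [folklore] -/
def hTabHullGo (tab : List CB) (k0 : ℕ) : ℕ → ℕ → CB → CB
  | 0, _, B => B
  | fuel + 1, k, B => hTabHullGo tab k0 fuel (k + 1) (hullCB B (hTabGet tab k0 k))

/-- Hull of `H_a, …, H_b` from the table (`a ≤ b`). [folklore] -/
def hTabHull (tab : List CB) (k0 a b : ℕ) : CB :=
  hTabHullGo tab k0 (b - a) (a + 1) (hTabGet tab k0 a)

/-! ### `H`-boxes from the Euler–Maclaurin formula -/

/-- Upper bound for `|s| = √(1 + τ²)`: the interval of `1 + τ²/2`. [folklore] -/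
def absS (tn td : ℕ) : FI := (FI.ofInt 1).add (((FI.ofFrac tn td).sqr).divNat 2)

/-- The widening `|s|(k₀⁻² + k₀⁻¹)·2^48` (rounded up) of the Euler–Maclaurin formula. [folklore] -/
def emErr (tn td k0 : ℕ) : ℤ :=
  let e : FI := (absS tn td).mul ((FI.ofFrac 1 (k0 * k0)).add (FI.ofFrac 1 k0))
  max 0 e.hi

/-- `i(Ψ − Ψ₀)/τ`: the closed form `(k^{-iτ} − k₀^{-iτ})·i/τ` from phase boxes. [folklore] -/
def emMain (tn td : ℕ) (Ψ Ψ0 : CB) : CB := (((Ψ.sub Ψ0).mulI).mulInt td).divNat tn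

/-- The box `H_{k₀} + i(Ψ − Ψ₀)/τ` widened by the Euler–Maclaurin error: contains `H_k(s)` for every
`k ≥ k₀` whose phase `k^{-iτ}` lies in `Ψ`. [folklore] -/
def emBox (tn td k0 : ℕ) (Hk0 Ψ Ψ0 : CB) : CB :=
  (Hk0.add (emMain tn td Ψ Ψ0)).widen (emErr tn td k0)

/-! ### One bin -/

/-- The state carried down the bins of a chunk: the grid index `i` of the upper edge `v = g_i` of the
next bin `(g_{i−1}, g_i]`, `v`, `Lv ∋ log v`, `Φv ∋ v^{-iτ}`, `k = ⌊N₁/v⌋`, `Lk ∋ log k`,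
`Ψk ∋ k^{-iτ}`, the remaining lower edges and table values, and the accumulators. [folklore] -/
structure BinState where
  /-- grid index of the upper edge of the next bin -/
  i : ℕ
  /-- `g_i` -/
  v : ℕ
  /-- enclosure of `log g_i` -/
  Lv : FI
  /-- point phase box at `g_i` -/
  Φv : CB
  /-- `⌊N₁ / g_i⌋` -/
  k : ℕ
  /-- enclosure of `log k` -/
  Lk : FI
  /-- point phase box at `k` -/
  Ψk : CB
  /-- `Ψk` is valid (it is not maintained inside the table region `k' ≤ k₀`) -/
  kph : Bool
  /-- remaining lower edges `g_{i−1}, g_{i−2}, …` (top first) -/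
  edges : List ℕ
  /-- `π(g_i)` (table chunks) -/
  piv : ℕ
  /-- remaining table values `π(g_{i−1}), π(g_{i−2}), …` (table chunks; else `[]`) -/
  pis : List ℕ
  /-- accumulated output -/
  out : ChunkOut

/-- The `H`-box over the `k`-range `[k, k']`: Euler–Maclaurin for `k ≥ k₀`, the table for
`k' ≤ k₀`, the hull of both across `k₀`. [folklore] -/
def hboxOf (P : WinParams) (tab : List CB) (Ψ0 Ψrange : CB) (k k' : ℕ) : CB :=
  bif Nat.ble P.k0 k then emBox P.tn P.td P.k0 P.Hk0 Ψrange Ψ0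
  else bif Nat.ble k' P.k0 then hTabHull tab P.k0 k k'
  else hullCB (hTabHull tab P.k0 k P.k0) (emBox P.tn P.td P.k0 P.Hk0 Ψrange Ψ0)

/-- The monotonicity test on the `k`-range `[k, k']` (skipped inside the table region, which the
table certifies): `Re((H − box widened by 1/k)·conj Ψ) ≥ 0`. [folklore] -/
def monoBinOf (P : WinParams) (k k' : ℕ) (Hbox Ψrange : CB) : Bool :=
  Nat.ble k' P.k0 || decide (0 ≤ (((Hbox.widen (cdiv SCZ k)).mul Ψrange.conj).re).lo)

/-- The `k`-phases of a bin: inside the table region (`k' ≤ k₀`, `k < k₀`) they are not needed (and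
not maintained: flag `false`); otherwise the point phase at `k` (carried, or recomputed by `expI` when
it was not maintained) is rotated up to `k'`: returns `(Ψrange, Ψk', flag)`. [folklore] -/
def kphaseOf (P : WinParams) (st : BinState) (k' : ℕ) (incrK : Option FI) (Lk' : FI) :
    Option (CB × CB × Bool) :=
  bif Nat.ble k' P.k0 && Nat.blt st.k P.k0 then some (st.Ψk, st.Ψk, false) else
  let startOpt : Option CB :=
    bif st.kph then some st.Ψk else
    match phaseBox P.tn P.td st.Lk st.Lk with
    | some B => some B
    | none => none
  match startOpt with
  | none => none
  | some Ψs =>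
    match phaseUp P.tn P.td Ψs incrK st.Lk Lk' with
    | some (Ψrange, Ψk') => some (Ψrange, Ψk', true)
    | none => none

/-- The update of the accumulators by the bin `(u, v]` with data `Z ∋ {t^{-iτ} H_{k(t)}}`, modulus
bounds `mlo ≤ 2^48|H| ≤ Mhi`, `Lu ∋ log u`, `Lv ∋ log v`, the prime count `c` (table bins) and the
monotonicity flag; `none` on an arithmetic failure. [folklore] -/
def accUpdate (P : WinParams) (E : EnvConsts) (i u v : ℕ) (c : ℕ) (o : ChunkOut) (Z : CB) (mlo Mhi : ℤ)
    (Lu Lv : FI) (monoBin : Bool) (k' : ℕ) : Option ChunkOut :=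
  let maxco' := max o.maxco (cdiv Mhi (u + 1))
  bif Nat.ble i E.iX then
    -- table bin: exact count
    let w : FI := ⟨SCZ / v, cdiv SCZ (u + 1)⟩          -- [1/v, 1/(u+1)]
    some { o with
      Rtab := o.Rtab + (c : ℤ) * mlo / v
      P0 := o.P0.add ((Z.mulFI w).mulInt c)
      maxco := maxco'
      allMono := o.allMono && monoBin
      kcert := k' }
  else
    -- envelope bin: density main term `μ = ∑_{u<n≤v} 1/(n log n)` and variation terms
    match (FI.ofInt ((v : ℤ) - u)).divPos (Lv.mulInt v),
        (FI.ofInt ((v : ℤ) - u)).divPos (Lu.mulInt u),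
        (FI.ofInt 1).divPos Lu,
        (FI.ofInt 1).divPos (Lv.add (FI.ofFrac 1 v)) with
    | some μv, some μu, some iLu, some iLv1 =>
      let μ : FI := ⟨μv.lo, μu.hi⟩
      let gx : ℤ := bif Nat.beq i (max E.iX P.iY + 1) then cdiv (Mhi * iLu.hi) SCZ else o.GX
      some { o with
        mainm := o.mainm + max 0 (μv.lo * mlo / SCZ)
        mainM := o.mainM + cdiv (μu.hi * Mhi) SCZ
        R2 := o.R2 + cdiv (Mhi * (iLu.hi - iLv1.lo)) SCZ
        P0 := o.P0.add (Z.mulFI μ)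
        maxco := maxco'
        GX := gx
        allMono := o.allMono && monoBin
        kcert := k' }
    | _, _, _, _ => none

/-- Force the carried values and the accumulators (kernel strictness); always `true`. [folklore] -/
def forceOK (o : ChunkOut) (Lu Lk' : FI) (Φu Ψk' : CB) : Bool :=
  decide (o.P0.re.lo ≤ o.P0.re.hi) && decide (o.P0.im.lo ≤ o.P0.im.hi) &&
    decide (o.Rtab ≤ o.Rtab) && decide (o.mainm ≤ o.mainM + o.mainM - o.mainm) &&
    decide (Lu.lo ≤ Lu.hi) && decide (Lk'.lo ≤ Lk'.hi) &&
    decide (Φu.re.lo ≤ Φu.re.hi) && decide (Φu.im.lo ≤ Φu.im.hi) &&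
    decide (Ψk'.re.lo ≤ Ψk'.re.hi) && decide (Ψk'.im.lo ≤ Ψk'.im.hi)

/-- Treat the bin `(u, v] = (g_{i−1}, g_i]` (its `k`-range taken as `[⌊N₁/v⌋, ⌊N₁/u⌋]`) and step
down to `i − 1`. [folklore] -/
def binStep (P : WinParams) (E : EnvConsts) (tab : List CB) (Ψ0 : CB) (N1 : ℕ) (st : BinState) :
    Option BinState :=
  match st.edges with
  | [] => none
  | u :: edges' =>
    let k' := N1 / u
    bif Nat.blt k' st.k || Nat.beq st.k 0 || Nat.ble st.v u then none else
    match logDown st.Lv st.v u, logUp st.Lk st.k k' with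
    | some (Lu, incrP), some (Lk', incrK) =>
      match phaseDown P.tn P.td st.Φv incrP Lu st.Lv, kphaseOf P st k' incrK Lk' with
      | some (Φbin, Φu), some (Ψrange, Ψk', kph') =>
        let Hbox := hboxOf P tab Ψ0 Ψrange st.k k'
        match absLoCB Hbox, absHiCB Hbox with
        | some mlo, some Mhi =>
          match accUpdate P E st.i u st.v (st.piv - st.pis.headD 0) st.out (Φbin.mul Hbox) mlo Mhi Lu st.Lv
              (monoBinOf P st.k k' Hbox Ψrange) k' with
          | some o' =>
            bif forceOK o' Lu Lk' Φu Ψk' then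
              some ⟨st.i - 1, u, Lu, Φu, k', Lk', Ψk', kph', edges', st.pis.headD 0, st.pis.tail, o'⟩
            else none
          | none => none
        | _, _ => none
      | _, _ => none
    | _, _ => none

/-- Walk the bins `i, i−1, …` down to (but excluding) index `stop` (fuel-recursive). [folklore] -/
def binsGo (P : WinParams) (E : EnvConsts) (tab : List CB) (Ψ0 : CB) (N1 stop : ℕ) :
    ℕ → BinState → Option BinState
  | 0, st => some st
  | fuel + 1, st =>
    bif Nat.ble st.i stop then some st else
    match binStep P E tab Ψ0 N1 st with
    | some st' => binsGo P E tab Ψ0 N1 stop fuel st'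
    | none => none

/-! ### Chunks -/

/-- The point phase box `∋ n^{-iτ}` from scratch (`expI`), with `log n`. [folklore] -/
def phasePt (P : WinParams) (n : ℕ) : Option (FI × CB) :=
  match logFI n with
  | some L =>
    match phaseBox P.tn P.td L L with
    | some B => some (L, B)
    | none => none
  | none => none

/-- The parameter guard of chunk `c` (`true` = reject): boundaries, positivity, and the region
condition (a chunk lies entirely in the table region, with the table long enough, or entirely in the
envelope region). [folklore] -/
def chunkGuard (P : WinParams) (E : EnvConsts) (piTab : List ℕ) (c : ℕ) : Bool :=
  let top := P.splits.getD c 0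
  let stop := P.splits.getD (c + 1) 0
  Nat.ble top stop || Nat.blt P.i1 top || Nat.blt stop P.iY || Nat.beq P.k0 0 ||
    Nat.beq P.tn 0 || Nat.beq P.td 0 || !(Nat.ble top E.iX || Nat.ble E.iX stop) ||
    (Nat.ble top E.iX && Nat.blt piTab.length (top + 1))

/-- The check of the claimed box `P.Hk0 ⊇` computed `H_{k₀}` (only when the table was built). [folklore] -/
def hk0Check (P : WinParams) (needTab : Bool) (tab : List CB) : Bool :=
  !needTab ||
    (match tab with
      | [] => false
      | H :: _ => decide (P.Hk0.re.lo ≤ H.re.lo) && decide (H.re.hi ≤ P.Hk0.re.hi) &&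
          decide (P.Hk0.im.lo ≤ H.im.lo) && decide (H.im.hi ≤ P.Hk0.im.hi))

/-- The initial data of chunk `c`: the `H`-table (built when the first `k` is below `k₀`, then with its
monotonicity flag and the `Hk0` check), the phase of `k₀`, and the initial state of the bin walk at
`i = top`. [folklore] -/
def chunkInit (P : WinParams) (E : EnvConsts) (piTab : List ℕ) (c : ℕ) :
    Option (List CB × CB × BinState) :=
  let N1 := gridPt P.i1
  let top := P.splits.getD c 0
  let stop := P.splits.getD (c + 1) 0
  bif chunkGuard P E piTab c then none else
  let v := gridPt top
  let k := N1 / v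
  bif Nat.beq k 0 then none else
  let needTab := Nat.blt k P.k0
  match (bif needTab then hTab P.tn P.td P.k0 else some ([], true)),
      phasePt P P.k0, phasePt P v, phasePt P k with
  | some (tab, tabMono), some (_, Ψ0), some (Lv, Φv), some (Lk, Ψk) =>
    bif hk0Check P needTab tab then
      let pisAll : List ℕ :=
        bif Nat.ble top E.iX then ((piTab.drop stop).take (top - stop + 1)).reverse else []
      some (tab, Ψ0, ⟨top, v, Lv, Φv, k, Lk, Ψk, true, gridDesc stop top, pisAll.headD 0, pisAll.tail,
        ⟨true, 0, 0, 0, 0, CB.ofInt 0, 0, 0, tabMono || !needTab, k⟩⟩)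
    else none
  | _, _, _, _ => none

/-- **One chunk.** Chunk `c` treats the bins with grid index `i`, `splits[c+1] < i ≤ splits[c]`, walking
down from `i = splits[c]` (`chunkInit`, then the bin walk `binsGo`). [folklore] -/
def chunkOut (P : WinParams) (E : EnvConsts) (piTab : List ℕ) (c : ℕ) : ChunkOut :=
  let stop := P.splits.getD (c + 1) 0
  match chunkInit P E piTab c with
  | none => ChunkOut.fail
  | some (tab, Ψ0, st0) =>
    match binsGo P E tab Ψ0 (gridPt P.i1) stop (st0.i - stop) st0 with
    | some st => bif Nat.beq st.i stop then st.out else ChunkOut.fail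
    | none => ChunkOut.fail

/-! ### Combination of the chunks and the final inequalities -/

/-- Sum of the chunk outputs (and conjunction of the flags); `kcert` = the largest `k` of the
maximal initial run of fully monotone chunks. [folklore] -/
def sumOuts : List ChunkOut → ChunkOut → ChunkOut
  | [], acc => acc
  | o :: rest, acc =>
    let mono := acc.allMono && o.allMono
    sumOuts rest
      ⟨acc.ok && o.ok, acc.Rtab + o.Rtab, acc.mainm + o.mainm, acc.mainM + o.mainM, acc.R2 + o.R2,
        acc.P0.add o.P0, max acc.maxco o.maxco, max acc.GX o.GX, mono,
        bif mono then max acc.kcert o.kcert else acc.kcert⟩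

/-- The jump terms: `J = ∑_groups (#group/k_min) / log ⌊N₁/k'⌋` over the groups `[k, k')`,
`k' = k + ⌈k/4⌉`, covering `[2, K]`: all of them (`all = true`) or only those reaching beyond `kcert`.
Fuel-recursive (`none` when the fuel is exhausted); `2^48`-scaled upper bound. [folklore] -/
def jumpGo (N1 K kcert : ℕ) (all : Bool) : ℕ → ℕ → ℤ → Option ℤ
  | 0, _, _ => none
  | fuel + 1, k, acc =>
    bif Nat.blt K k then some acc else
    let k' := min (K + 1) (k + max 1 (k / 4))
    bif !all && Nat.ble (k' - 1) kcert then jumpGo N1 K kcert all fuel k' acc else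
    match logFI (N1 / k') with
    | some L =>
      bif decide (L.lo ≤ 0) then none else
      -- (#group / k) / log(N₁/k'), rounded up:  (k'-k)·2^48·2^48 / (k · L.lo)
      let t : ℤ := cdiv (((k' : ℤ) - k) * SCZ * SCZ) ((k : ℤ) * L.lo)
      bif decide (t ≤ t) then jumpGo N1 K kcert all fuel k' (acc + t) else none
    | none => none

/-- `J_all` (`all = true`) or `J⁺` (`all = false`). [folklore] -/
def jumpSum (N1 K kcert : ℕ) (all : Bool) : Option ℤ := jumpGo N1 K kcert all (4 * K + 64) 2 0

/-- The initial accumulator of `sumOuts`. [folklore] -/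
def initOut : ChunkOut := ⟨true, 0, 0, 0, 0, CB.ofInt 0, 0, 0, true, 0⟩

/-- Structural sanity of the parameters and of the combined output `o`. [folklore] -/
def structOK (P : WinParams) (E : EnvConsts) (outs : List ChunkOut) (o : ChunkOut) : Bool :=
  let N1 := gridPt P.i1
  let N2 := gridPt P.i2
  let Y := gridPt P.iY
  o.ok && Nat.blt P.i1 P.i2 && Nat.blt P.iY P.i1 && Nat.ble N2 (Y * Y) &&
    Nat.beq (P.splits.getD 0 0) P.i1 && Nat.beq (P.splits.getLastD 0) P.iY &&
    Nat.beq (outs.length + 1) P.splits.length &&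
    Nat.blt 0 P.tn && Nat.blt 0 P.td && Nat.blt 1 P.k0 && Nat.ble P.k0 N1 &&
    Nat.blt 0 E.ed && Nat.ble E.an E.ed && Nat.ble E.ed E.bn && Nat.blt 20 Y &&
    decide (0 ≤ o.mainm) && decide (0 ≤ o.Rtab) && decide (0 ≤ o.GX) && decide (0 ≤ o.R2) &&
    decide (0 ≤ o.mainM)

/-- The envelope error terms `(ER, EP)` (zero when the window lies inside the table):
`ER = ((1−α)·mainm + (β−α)(G_X + J⁺))`, `EP = η(1/log N₁ + G_X + |s|·mainM + R₂ + J_all)`,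
`η = max(1−α, β−1)`, from `iLN1hi ≥ 2^48/log N₁`. [folklore] -/
def envTerms (P : WinParams) (E : EnvConsts) (o : ChunkOut) (iLN1hi : ℤ) : Option (ℤ × ℤ) :=
  bif Nat.ble P.i1 E.iX then some (0, 0) else
  let N1 := gridPt P.i1
  let K := N1 / (gridPt E.iX + 1)
  match jumpSum N1 K o.kcert true, jumpSum N1 K o.kcert false with
  | some Jall, some Jplus =>
    let oneMinusA : ℤ := (E.ed : ℤ) - E.an
    let betaMinusA : ℤ := (E.bn : ℤ) - E.an
    let etaN : ℤ := max ((E.ed : ℤ) - E.an) ((E.bn : ℤ) - E.ed)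
    let sM : ℤ := cdiv ((absS P.tn P.td).hi * o.mainM) SCZ
    let ER : ℤ := cdiv (oneMinusA * o.mainm + betaMinusA * (o.GX + Jplus)) E.ed
    let EP : ℤ := cdiv (etaN * (iLN1hi + o.GX + sM + o.R2 + Jall)) E.ed
    some (ER, EP)
  | _, _ => none

/-- **The combination.** From the chunk outputs: the envelope error terms (`envTerms`), the drift
`Δ = (N₂ − N₁)/(N₁+1)`, the box of `H_{N₁}` (Euler–Maclaurin from `Hk0`),
`Bfin ≥ |H_{N₁} − P₀| + EP + Δ`, `Rfin ≤ R − ER − Δ`, and the left side `2·(1 + log N₂)/(Y'+1)` of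
the second condition; returns `(Rfin, Bfin, h2lhs, 2·maxco − Δ)` (all `2^48`-scaled), or `none` on
any failure. [folklore] -/
def verdict (P : WinParams) (E : EnvConsts) (outs : List ChunkOut) : Option (ℤ × ℤ × ℤ × ℤ) :=
  let N1 := gridPt P.i1
  let N2 := gridPt P.i2
  let Y := gridPt P.iY
  let o := sumOuts outs initOut
  bif !structOK P E outs o then none else
  match phasePt P P.k0, phasePt P N1, logFI N2 with
  | some (_, Ψ0), some (LN1, ΨN), some LN2 =>
    let HN1 : CB := emBox P.tn P.td P.k0 P.Hk0 ΨN Ψ0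
    let Bbox := HN1.sub o.P0
    match absHiCB Bbox, (FI.ofInt 1).divPos LN1 with
    | some Babs, some iLN1 =>
      match envTerms P E o iLN1.hi with
      | none => none
      | some (ER, EP) =>
        let Δ : ℤ := cdiv (((N2 : ℤ) - N1) * SCZ) ((N1 : ℤ) + 1)
        let Rfin : ℤ := o.Rtab + o.mainm - ER - Δ
        let Bfin : ℤ := Babs + EP + Δ
        let h2lhs : ℤ := cdiv (2 * (SCZ + LN2.hi)) ((Y : ℤ) + 1)
        some (Rfin, Bfin, h2lhs, 2 * o.maxco - Δ)
    | _, _ => none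
  | _, _, _ => none

/-- **The verdict**: both strict inequalities of the criterion, `Bfin < Rfin` and `h2lhs < Rfin`
(and the cross-check `2·maxco − Δ < Rfin` at `N₁`). [folklore] -/
def combine (P : WinParams) (E : EnvConsts) (outs : List ChunkOut) : Bool :=
  match verdict P E outs with
  | some (Rfin, Bfin, h2lhs, mc) => decide (Bfin < Rfin) && decide (h2lhs < Rfin) && decide (mc < Rfin)
  | none => false

end Literature.Barriers.RiemannHypothesis.TuranWindow
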